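import Summits.QuantumFields.BalabanUV.T4Continuum.Support.VectorBlockTrialFormCovariant

/-!
# T⁴ programme, spine node NE2 (U1a), lane P2 — SUPPLIER LEAF V-UB FOR LINE-INDEXED TRANSPORTS, part 1: the line-sum average with transports indexed by
# (start block, start digit, position, direction) — the printed structure of [B7] (125) ∕ [B9] (3.13)–(3.15) — and the DEFECT OPERATOR `K` of the tilted
# competitor against a bond-indexed reference: `Q_T(S₀·κ⁻¹ψ_φ) = φ + Kφ`, `‖(Kφ)(y,μ)‖ ≤ κ⁻¹γ·(a₀‖φ(y,μ)‖ + a₁‖φ(y+e_μ,μ)‖)`, `a₀ + a₁ ≤ 1`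

NE2 formalisation swarm `b2b-balaban-t4-ne2-formalise-*`, leaf 03 GEN 4 (`prover-b2b-balaban-t4-ne2-formalise-leaf-03-g4-0`); follows the located note N-ne2leaf03g4-1
(journal 2026-08-20 ≈10:52Z, GAPS): my `QvT` (p215552) indexes the line transport by the BOND; the printed one-step averaging [Balaban1985AveragingOperations] (125)
«(Q₀A)_c = Σ_{x∈B(c₋)} L^{−(d+1)} R(V₀; c₋, x)(A([x, x_c]))» (used by [Balaban1985BackgroundPropagators] (3.13)–(3.15)) transports the bond variable at position `s`
of the line started at `x` by `R(Γ_{c₋,x})·R(x → x + s e_μ)` — a transport indexed by the LINE.  THIS FILE types that structure (SHAPE only; transports DATA):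
 * §1 `QvL n M T W y μ := n^{−(d+1)} • Σ_j Σ_{t<n} T y j t μ (W (n·y + j + t e_μ) μ)`, `T : Tor M → (Fin d → Fin n) → Fin n → Fin d → (E →L[ℂ] E)`;
   `QvT_eq_QvL` (the bond-indexed `QvT` of p215552 is the special case, by `rfl`);
 * §2 against a bond-indexed REFERENCE right inverse `S₀` the tilted competitor `compV S₀ φ = S₀·κ⁻¹ψ_φ` (p215552) gives **`QvL_compV_eq : Q_T(compV S₀ φ)(y,μ) = φ(y,μ)
   + (Kφ)(y,μ)`** with the DEFECT OPERATOR `Kdef T S₀ φ y μ := n^{−(d+1)}κ⁻¹ • Σ_j Σ_t (T(y,j,t,μ)∘S₀(p,μ) − 1)(ψ_φ(p,μ))` (the exact part is file 1's `QvV_trialV`);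
 * §3 under the relative bound `‖T(y,j,t,μ)∘S₀(p,μ) − 1‖ ≤ γ`: **`norm_Kdef_le : ‖(Kφ)(y,μ)‖ ≤ κ⁻¹γ·(a₀·‖φ(y,μ)‖ + a₁·‖φ(y+e_μ,μ)‖)`** where
   `a₀ = n^{−(d+1)}(nβ₁)^{d−1}·Σ_s(s+1)b(s)` (own-block mass) and `a₁ = n^{−(d+1)}(nβ₁)^{d−1}·Σ_s(n−1−s)b(s)` (spill mass), **`coef_facts : a₀, a₁ ≥ 0, a₀ + a₁ = β₁^d ≤ 1`**
   (`mass_facts`: `A₀ + A₁ = n²β₁`) — the window count of file 1 (`sum_window`, `trialV_line_lt/ge`, `sum_transverse_mass`) run on the NORMS (`|a| ≤ 1`, `b ≥ 0`).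
Part 2 (`VectorLineTransportUpperBound`): `Σ‖Kφ‖² ≤ (κ⁻¹γ)²Σ‖φ‖²`, `1 + K` invertible for `κ⁻¹γ < 1` (finite dimension), and V-UB with constant `Λ_V(n·w)/(1 − κ⁻¹γ)²`.

HONEST FRAMING (T4-DAG p. 1).  Model level; transports DATA (continuous linear maps; no group structure, no identification with Bałaban's `R(Γ)` beyond the SHAPE of
(125) — c5); [folklore] lattice calculus; nothing printed is a hypothesis; data `def`s `QvL`, `Kdef`, `massOwn`, `massSpill`, `coefOwn`, `coefSpill`, no `def … : Prop`,
no `sorry`; axioms standard.  NE2 NOT proved; spine 0/9; rung (B)+1 finite T⁴ — NOT infinite volume, NOT mass gap, NOT Clay.  HONEST DEPENDENCY (cell, verbatim):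
continuum YM on T⁴ ⇐ BetaPertH ∧ nine spine estimates (0/9 proved); BetaPertH ⇐ (D1) ∧ (D4) ∧ CAP+tail; G-an2-4 gates asym, D1 and NE2/3/4.
-/

noncomputable section

namespace Summit.QuantumFields.BalabanUV.T4Continuum.VectorBlockTrialForm

open Finset
open scoped ComplexConjugate Matrix
open Literature.MathematicalPhysics.QuantumFieldTheory.Balaban1983to89
open Literature.MathematicalPhysics.QuantumFieldTheory.Balaban1983to89.B5Prop11Plancherel (Tor fine unitVec)
open Literature.MathematicalPhysics.QuantumFieldTheory.Balaban1983to89.B5Block118 (tstep bpt)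
open Literature.MathematicalPhysics.QuantumFieldTheory.Balaban1983to89.B5Blocks16 (blockOf blockOf_bpt)
open Summit.QuantumFields.BalabanUV.T4Continuum.ScalarBlockTrialFunction (digits digits_bpt bump bump_mem beta1 beta1_ge avg_bump_eq bumpW bumpW_mem bumpW_update)
open Summit.QuantumFields.BalabanUV.T4Continuum.VariationalCovariantFederbush (sum_sq_add_le)

variable {d : ℕ} (n : ℕ) [NeZero n] (M : Fin d → ℕ) [hM : ∀ μ, NeZero (M μ)]
variable {E : Type*} [NormedAddCommGroup E] [NormedSpace ℂ E]

/-! ## §1 The LINE-indexed transported average (the printed [B7] (125) ∕ [B9] (3.13) structure): one transport per (start block, start digit, position, direction) -/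

/-- **the line-sum average with LINE-INDEXED transports**: `(Q_T W)(y,μ) = n^{−(d+1)} • Σ_j Σ_{t<n} T(y, j, t, μ)(W(n·y + j + t e_μ, μ))` — the transport of the
bond variable at position `t` of the line started at `n·y + j` may depend on the LINE ([Balaban1985AveragingOperations] (125) «R(V₀; c₋, x)(A([x, x_c]))»,
[Balaban1985BackgroundPropagators] (3.13)–(3.15) SHAPE; transports DATA).  `QvT` (bond-indexed) is the special case `T y j t μ := Tl (bpt y j + tstep μ t) μ`. [folklore] -/
def QvL (T : Tor M → (Fin d → Fin n) → Fin n → Fin d → (E →L[ℂ] E)) (W : Tor (fine n M) → Fin d → E) (y : Tor M) (μ : Fin d) : E :=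
  (((n : ℂ) ^ (d + 1))⁻¹ : ℂ) • ∑ j : Fin d → Fin n, ∑ t : Fin n, T y j t μ (W (bpt n M y j + tstep (fine n M) μ t) μ)

omit [NeZero n] hM in
/-- bond-indexed transports are the special case: `QvT Tl = QvL (y j t μ ↦ Tl (n·y + j + t e_μ) μ)`. [folklore] -/
theorem QvT_eq_QvL (Tl : Tor (fine n M) → Fin d → (E →L[ℂ] E)) (W : Tor (fine n M) → Fin d → E) :
    QvT n M Tl W = QvL n M (fun y j t μ => Tl (bpt n M y j + tstep (fine n M) μ t) μ) W := rfl

/-! ## §2 The competitor against a bond-indexed REFERENCE `S₀`: `Q_T(S₀·κ⁻¹ψ_{φ′}) = φ′ + K φ′` with the DEFECT OPERATOR `K` -/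

/-- the DEFECT OPERATOR `(K φ′)(y,μ) := n^{−(d+1)}κ⁻¹ • Σ_j Σ_t (T(y,j,t,μ)∘S₀(p,μ) − 1)(ψ_{φ′}(p, μ))`, `p = n·y + j + t e_μ`. [folklore] -/
def Kdef (T : Tor M → (Fin d → Fin n) → Fin n → Fin d → (E →L[ℂ] E)) (S₀ : Tor (fine n M) → Fin d → (E →L[ℂ] E)) (φ : Tor M → Fin d → E)
    (y : Tor M) (μ : Fin d) : E :=
  ((((n : ℂ) ^ (d + 1))⁻¹ * (((kappaV d n)⁻¹ : ℝ) : ℂ)) : ℂ) •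
    ∑ j : Fin d → Fin n, ∑ t : Fin n, (T y j t μ * S₀ (bpt n M y j + tstep (fine n M) μ t) μ - 1) (trialV n M φ (bpt n M y j + tstep (fine n M) μ t) μ)

/-- **`Q_T(S₀·κ⁻¹ψ_{φ′}) = φ′ + K φ′`**: the exact part is file 1's `QvV_trialV` (`κ⁻¹·κ = 1`), the rest is the defect operator. [folklore] -/
theorem QvL_compV_eq (T : Tor M → (Fin d → Fin n) → Fin n → Fin d → (E →L[ℂ] E)) (S₀ : Tor (fine n M) → Fin d → (E →L[ℂ] E))
    (φ : Tor M → Fin d → E) (y : Tor M) (μ : Fin d) :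
    QvL n M T (compV n M S₀ φ) y μ = φ y μ + Kdef n M T S₀ φ y μ := by
  have hd : 1 ≤ d := Nat.succ_le_of_lt (Fin.pos μ)
  have hn : 0 < n := Nat.pos_of_ne_zero (NeZero.ne n)
  have hκ : ((kappaV d n : ℝ) : ℂ) ≠ 0 := by exact_mod_cast (kappaV_pos hd hn).ne'
  have hmain := congrFun (congrFun (QvV_trialV n M φ) y) μ
  unfold QvV at hmain
  -- split `T S₀ v = v + (T S₀ − 1) v`
  have hsplit : ∀ (j : Fin d → Fin n) (t : Fin n),
      T y j t μ (compV n M S₀ φ (bpt n M y j + tstep (fine n M) μ t) μ)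
        = (((kappaV d n)⁻¹ : ℝ) : ℂ) • trialV n M φ (bpt n M y j + tstep (fine n M) μ t) μ
          + (((kappaV d n)⁻¹ : ℝ) : ℂ) • (T y j t μ * S₀ (bpt n M y j + tstep (fine n M) μ t) μ - 1) (trialV n M φ (bpt n M y j + tstep (fine n M) μ t) μ) := by
    intro j t
    simp only [compV, map_smul, sub_apply, mul_apply_eq_comp, one_apply_eq_self, smul_sub]
    abel
  unfold QvL Kdef
  simp_rw [hsplit, sum_add_distrib, smul_add, ← Finset.smul_sum, smul_smul]
  rw [mul_comm (((n : ℂ) ^ (d + 1))⁻¹) _, ← smul_smul, hmain, smul_smul]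
  congr 1
  have e : (((kappaV d n)⁻¹ : ℝ) : ℂ) * ((kappaV d n : ℝ) : ℂ) = 1 := by push_cast; exact inv_mul_cancel₀ hκ
  rw [e, one_smul]

/-! ## §3 The size of the defect operator: `‖(Kφ)(y,μ)‖ ≤ κ⁻¹γ·(a₀‖φ(y,μ)‖ + a₁‖φ(y+e_μ,μ)‖)`, `a₀ + a₁ = β₁^d ≤ 1`, hence `Σ‖Kφ‖² ≤ (κ⁻¹γ)²·Σ‖φ‖²` -/

/-- own-block and spill masses of the bump along one line direction: `A₀ = Σ_{s<n}(s+1)b(s)`, `A₁ = Σ_{s<n}(n−1−s)b(s)`. [folklore] -/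
def massOwn (n : ℕ) : ℝ := ∑ s ∈ range n, ((s : ℝ) + 1) * bump n s

/-- the spill mass `A₁ = Σ_{s<n}(n−1−s)b(s)`. [folklore] -/
def massSpill (n : ℕ) : ℝ := ∑ s ∈ range n, ((n : ℝ) - 1 - s) * bump n s

omit hM in
/-- `A₀, A₁ ≥ 0` and `A₀ + A₁ = n·Σ_s b(s) = n²β₁`. [folklore] -/
theorem mass_facts : 0 ≤ massOwn n ∧ 0 ≤ massSpill n ∧ massOwn n + massSpill n = (n : ℝ) ^ 2 * beta1 n := by
  have hb : ∀ s ∈ range n, 0 ≤ bump n s := fun s hs => (bump_mem n s (mem_range.mp hs)).1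
  have hc : ∀ s ∈ range n, (0 : ℝ) ≤ (n : ℝ) - 1 - s := fun s hs => by
    have h1 : s + 1 ≤ n := mem_range.mp hs
    have h2 : (s : ℝ) + 1 ≤ n := by exact_mod_cast h1
    linarith
  refine ⟨sum_nonneg fun s hs => mul_nonneg (by positivity) (hb s hs), sum_nonneg fun s hs => mul_nonneg (hc s hs) (hb s hs), ?_⟩
  unfold massOwn massSpill
  rw [← sum_add_distrib]
  have e : ∀ s ∈ range n, ((s : ℝ) + 1) * bump n s + ((n : ℝ) - 1 - s) * bump n s = (n : ℝ) * bump n s := fun s _ => by ring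
  rw [sum_congr rfl e, ← mul_sum, Finset.sum_range (fun s => bump n s), ← avg_bump_eq n]
  have hn' : (n : ℝ) ≠ 0 := by exact_mod_cast NeZero.ne n
  field_simp

/-- the normalised coefficients `a₀ := n^{−(d+1)}(nβ₁)^{d−1}A₀`, `a₁ := n^{−(d+1)}(nβ₁)^{d−1}A₁`. [folklore] -/
def coefOwn (d n : ℕ) : ℝ := ((n : ℝ) ^ (d + 1))⁻¹ * ((n : ℝ) * beta1 n) ^ (d - 1) * massOwn n

/-- `a₁`. [folklore] -/
def coefSpill (d n : ℕ) : ℝ := ((n : ℝ) ^ (d + 1))⁻¹ * ((n : ℝ) * beta1 n) ^ (d - 1) * massSpill n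

omit hM in
/-- `a₀, a₁ ≥ 0`, `a₀ + a₁ = β₁^d ≤ 1` (`d ≥ 1`). [folklore] -/
theorem coef_facts (hd : 1 ≤ d) : 0 ≤ coefOwn d n ∧ 0 ≤ coefSpill d n ∧ coefOwn d n + coefSpill d n ≤ 1 := by
  obtain ⟨h0, h1, hsum⟩ := mass_facts n
  have hn : (0 : ℝ) < n := by exact_mod_cast Nat.pos_of_ne_zero (NeZero.ne n)
  have hn1 : (1 : ℝ) ≤ n := by exact_mod_cast Nat.pos_of_ne_zero (NeZero.ne n)
  obtain ⟨-, hβ0⟩ := beta1_ge n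
  have hβ1 : beta1 n ≤ 1 := by
    unfold beta1; rw [div_le_one (by positivity)]; nlinarith
  refine ⟨by unfold coefOwn; positivity, by unfold coefSpill; positivity, ?_⟩
  obtain ⟨d', rfl⟩ : ∃ d', d = d' + 1 := ⟨d - 1, by omega⟩
  have e : coefOwn (d' + 1) n + coefSpill (d' + 1) n = beta1 n ^ (d' + 1) := by
    unfold coefOwn coefSpill
    rw [← mul_add, hsum, Nat.add_sub_cancel, mul_pow]
    field_simp
    ring
  rw [e]
  exact pow_le_one₀ hβ0.le hβ1

/-- **POINTWISE SIZE OF THE DEFECT OPERATOR**: `‖(Kφ)(y,μ)‖ ≤ κ⁻¹γ·(a₀·‖φ(y,μ)‖ + a₁·‖φ(y+e_μ,μ)‖)` under `‖T(y,j,t,μ)∘S₀(p,μ) − 1‖ ≤ γ` — window count of the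
norms of the trial form along every transverse fibre (`|a| ≤ 1`, `b ≥ 0`). [folklore] -/
theorem norm_Kdef_le {T : Tor M → (Fin d → Fin n) → Fin n → Fin d → (E →L[ℂ] E)} {S₀ : Tor (fine n M) → Fin d → (E →L[ℂ] E)} {γ : ℝ}
    (hrel : ∀ y j t μ, ‖T y j t μ * S₀ (bpt n M y j + tstep (fine n M) μ t) μ - 1‖ ≤ γ) (φ : Tor M → Fin d → E) (y : Tor M) (μ : Fin d) :
    ‖Kdef n M T S₀ φ y μ‖ ≤ (kappaV d n)⁻¹ * γ * (coefOwn d n * ‖φ y μ‖ + coefSpill d n * ‖φ (y + unitVec M μ) μ‖) := by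
  have hd : 1 ≤ d := Nat.succ_le_of_lt (Fin.pos μ)
  have hn : 0 < n := Nat.pos_of_ne_zero (NeZero.ne n)
  have hn0 : (0 : ℝ) < n := by exact_mod_cast hn
  have hκ0 : 0 < (kappaV d n)⁻¹ := inv_pos.mpr (kappaV_pos hd hn)
  have hγ0 : 0 ≤ γ := (norm_nonneg _).trans (hrel y (fun _ => 0) 0 μ)
  -- Step 1: triangle inequality, each summand ≤ γ‖ψ‖
  have h1 : ‖Kdef n M T S₀ φ y μ‖ ≤ ((n : ℝ) ^ (d + 1))⁻¹ * (kappaV d n)⁻¹ *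
      ∑ j : Fin d → Fin n, ∑ t : Fin n, γ * ‖trialV n M φ (bpt n M y j + tstep (fine n M) μ t) μ‖ := by
    unfold Kdef
    rw [norm_smul]
    have hc : ‖(((n : ℂ) ^ (d + 1))⁻¹ * (((kappaV d n)⁻¹ : ℝ) : ℂ))‖ = ((n : ℝ) ^ (d + 1))⁻¹ * (kappaV d n)⁻¹ := by
      rw [norm_mul, norm_inv, norm_pow, Complex.norm_natCast, Complex.norm_real, Real.norm_of_nonneg hκ0.le]
    rw [hc]
    refine mul_le_mul_of_nonneg_left ((norm_sum_le _ _).trans (sum_le_sum fun j _ => (norm_sum_le _ _).trans (sum_le_sum fun t _ => ?_))) (by positivity)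
    exact (ContinuousLinearMap.le_opNorm _ _).trans (mul_le_mul_of_nonneg_right (hrel y j t μ) (norm_nonneg _))
  -- Step 2: the window count of the norms along every transverse fibre
  have h2 : ∑ j : Fin d → Fin n, ∑ t : Fin n, ‖trialV n M φ (bpt n M y j + tstep (fine n M) μ t) μ‖
      ≤ ((n : ℝ) * beta1 n) ^ (d - 1) * (massOwn n * ‖φ y μ‖ + massSpill n * ‖φ (y + unitVec M μ) μ‖) := by
    rw [← (Equiv.funSplitAt μ (Fin n)).symm.sum_comp, Fintype.sum_prod_type, Finset.sum_comm]
    -- per transverse fibre `q`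
    have hq : ∀ q : {ν // ν ≠ μ} → Fin n,
        ∑ i : Fin n, ∑ t : Fin n, ‖trialV n M φ (bpt n M y ((Equiv.funSplitAt μ (Fin n)).symm (i, q)) + tstep (fine n M) μ t) μ‖
          ≤ (∏ ν ∈ univ.erase μ, bump n (((Equiv.funSplitAt μ (Fin n)).symm (0, q)) ν)) * (massOwn n * ‖φ y μ‖ + massSpill n * ‖φ (y + unitVec M μ) μ‖) := by
      intro q
      set j₀ : Fin d → Fin n := (Equiv.funSplitAt μ (Fin n)).symm (0, q) with hj₀
      set R : ℝ := ∏ ν ∈ univ.erase μ, bump n (j₀ ν) with hR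
      have hR0 : 0 ≤ R := prod_nonneg fun ν _ => (bump_mem n _ (j₀ ν).is_lt).1
      have hj : j₀ μ = 0 := (funSplitAt_symm_eq n μ 0 q).2
      set h : ℕ → ℝ := fun s => ‖trialV n M φ (bpt n M y j₀ + tstep (fine n M) μ s) μ‖ with hh
      have step1 : ∑ i : Fin n, ∑ t : Fin n, ‖trialV n M φ (bpt n M y ((Equiv.funSplitAt μ (Fin n)).symm (i, q)) + tstep (fine n M) μ t) μ‖
          = ∑ i ∈ range n, ∑ t ∈ range n, h (i + t) := by
        rw [Finset.sum_range (fun i => ∑ t ∈ range n, h (i + t))]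
        refine Fintype.sum_congr _ _ fun i => ?_
        rw [Finset.sum_range (fun t => h (i + t))]
        refine Fintype.sum_congr _ _ fun t => ?_
        rw [(funSplitAt_symm_eq n μ i q).1, hh]
        simp only
        rw [tstep_add, ← add_assoc, line_point_lt n M y hj i i.is_lt]
      have ha : ∀ s, s < n → |bump n s * R * tilt n s| ≤ bump n s * R := fun s hs => by
        rw [abs_mul, abs_of_nonneg (mul_nonneg (bump_mem n s hs).1 hR0)]
        exact mul_le_of_le_one_right (mul_nonneg (bump_mem n s hs).1 hR0) (abs_tilt_le_one s hs)
      have hw1 : ∀ s ∈ range n, (s + 1) • h s ≤ R * (((s : ℝ) + 1) * bump n s * ‖φ y μ‖) := by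
        intro s hs
        rw [mem_range] at hs
        rw [hh]; simp only
        rw [trialV_line_lt n M φ y hj s hs, ← hR, ← Nat.cast_smul_eq_nsmul ℝ, smul_eq_mul, norm_smul, Complex.norm_real, Real.norm_eq_abs]
        have h3 := mul_le_mul_of_nonneg_right (ha s hs) (norm_nonneg (φ y μ))
        push_cast
        calc ((s : ℝ) + 1) * (|bump n s * R * tilt n s| * ‖φ y μ‖) ≤ ((s : ℝ) + 1) * (bump n s * R * ‖φ y μ‖) :=
            mul_le_mul_of_nonneg_left h3 (by positivity)
          _ = R * (((s : ℝ) + 1) * bump n s * ‖φ y μ‖) := by ring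
      have hw2 : ∀ s ∈ range n, (n - 1 - s) • h (n + s) ≤ R * (((n : ℝ) - 1 - s) * bump n s * ‖φ (y + unitVec M μ) μ‖) := by
        intro s hs
        rw [mem_range] at hs
        have hc : ((n - 1 - s : ℕ) : ℝ) = (n : ℝ) - 1 - s := by
          have e : (n - 1 - s) + s + 1 = n := by omega
          have e' := congrArg (Nat.cast : ℕ → ℝ) e
          push_cast at e'
          linarith
        have hcs : (0 : ℝ) ≤ (n : ℝ) - 1 - s := by rw [← hc]; exact Nat.cast_nonneg _
        rw [hh]; simp only
        rw [trialV_line_ge n M φ y hj s hs, ← hR, ← Nat.cast_smul_eq_nsmul ℝ, hc, smul_eq_mul, norm_smul, Complex.norm_real, Real.norm_eq_abs]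
        have h3 := mul_le_mul_of_nonneg_right (ha s hs) (norm_nonneg (φ (y + unitVec M μ) μ))
        calc ((n : ℝ) - 1 - s) * (|bump n s * R * tilt n s| * ‖φ (y + unitVec M μ) μ‖)
            ≤ ((n : ℝ) - 1 - s) * (bump n s * R * ‖φ (y + unitVec M μ) μ‖) := mul_le_mul_of_nonneg_left h3 hcs
          _ = R * (((n : ℝ) - 1 - s) * bump n s * ‖φ (y + unitVec M μ) μ‖) := by ring
      rw [step1, sum_window]
      calc ∑ s ∈ range n, (s + 1) • h s + ∑ s ∈ range n, (n - 1 - s) • h (n + s)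
          ≤ ∑ s ∈ range n, R * (((s : ℝ) + 1) * bump n s * ‖φ y μ‖) + ∑ s ∈ range n, R * (((n : ℝ) - 1 - s) * bump n s * ‖φ (y + unitVec M μ) μ‖) :=
            add_le_add (sum_le_sum hw1) (sum_le_sum hw2)
        _ = R * (massOwn n * ‖φ y μ‖ + massSpill n * ‖φ (y + unitVec M μ) μ‖) := by
            unfold massOwn massSpill
            rw [← mul_sum, ← mul_sum, sum_mul, sum_mul]
            ring
    calc ∑ q : {ν // ν ≠ μ} → Fin n, ∑ i : Fin n, ∑ t : Fin n,
          ‖trialV n M φ (bpt n M y ((Equiv.funSplitAt μ (Fin n)).symm (i, q)) + tstep (fine n M) μ t) μ‖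
        ≤ ∑ q : {ν // ν ≠ μ} → Fin n, (∏ ν ∈ univ.erase μ, bump n (((Equiv.funSplitAt μ (Fin n)).symm (0, q)) ν)) *
            (massOwn n * ‖φ y μ‖ + massSpill n * ‖φ (y + unitVec M μ) μ‖) := sum_le_sum fun q _ => hq q
      _ = _ := by rw [← sum_mul, sum_transverse_mass]
  -- Step 3: assemble
  have hγs : ∑ j : Fin d → Fin n, ∑ t : Fin n, γ * ‖trialV n M φ (bpt n M y j + tstep (fine n M) μ t) μ‖
      = γ * ∑ j : Fin d → Fin n, ∑ t : Fin n, ‖trialV n M φ (bpt n M y j + tstep (fine n M) μ t) μ‖ := by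
    rw [mul_sum]; exact sum_congr rfl fun j _ => by rw [mul_sum]
  rw [hγs] at h1
  calc _ ≤ _ := h1
    _ ≤ ((n : ℝ) ^ (d + 1))⁻¹ * (kappaV d n)⁻¹ * (γ * (((n : ℝ) * beta1 n) ^ (d - 1) * (massOwn n * ‖φ y μ‖ + massSpill n * ‖φ (y + unitVec M μ) μ‖))) :=
        mul_le_mul_of_nonneg_left (mul_le_mul_of_nonneg_left h2 hγ0) (by positivity)
    _ = _ := by unfold coefOwn coefSpill; ring

end Summit.QuantumFields.BalabanUV.T4Continuum.VectorBlockTrialForm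

end
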